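import Summits.ABC.IUTFork.LDHSplitBadPrimeLargeL
import Summits.ABC.IUTFork.LDHInitialThetaDataPerPacket
import HarnessLib

/-!
# The fork at [IUTchIII] Corollary 3.12, L-DH level: the bad-mass TRUE side AT INITIAL Θ-DATA — for `D` whose chosen bad places
# over each rational prime carry at most half of `[F_mod:ℚ]`, the typed `Cor312Of` HOLDS for the GENUINE input of `D`, every idele datum

Proof-only companion (D-0012; 0 definitions, no `Prop` fact) of `LDHSplitBadPrimeNumberField.lean` / `LDHSplitBadPrimeLargeL.lean`
(abc-iut-w5-d018, p430071 / p430596) and abc-iut-w5-d157's `LDHInitialThetaDataPerPacket.lean`; WAVE-5 prover abc-iut-w5-d018 (gen 4).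
TAKES NO SIDE on [IUTchIII] Cor. 3.12.

The companions are stated for arbitrary (possibly synthetic) inhabitants of abc-iut-S2's input type. HERE they are read AT INITIAL
Θ-DATA `D : InitialThetaData F K F̄ E l Pb` ([IUTchI] Def. 3.1) through abc-iut-S2's GENUINE Θ-volume input `volumeInputOf D r`
(pilot data `(j_E, 𝕍^bad_mod, l)` of `D` over the field of moduli `F_mod = ℚ(j_E)`, `D`'s section `V̲`, and an idele datum `r`
realising `P_Θ`, `P_q` — the `2l`-th roots of the Tate parameters of [IUTchIV] Step (v)), for EVERY `r`:

* **`InitialThetaData.cor312Of_volumeInputOf_of_badMass_le_half`** — if at every support prime `p` the CHOSEN bad places of `D` over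
  `p` carry at most half of the degree of the field of moduli, `Σ_{v|p, v∈𝕍^bad_mod} n_v ≤ [F_mod:ℚ]/2`, then Dupuy–Hilado's (1.1)
  (`Cor312NonarchOf`) and [IUTchIII] Cor. 3.12 as typed (`Cor312Of`) HOLD for `volumeInputOf D r` — WHATEVER the curve's height,
  the depths `ord_v(q_v)`, the idele datum. ([IUTchI] Def. 3.1 (b): `𝕍^bad_mod` is «a nonempty set of nonarchimedean valuations of
  `F_mod` of odd residue characteristic over which `E_F` has bad multiplicative reduction» — a CHOICE; e.g. a single place of
  local degree `1` over a completely split prime of `F_mod ≠ ℚ` where `E_F` has multiplicative reduction.)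
* `InitialThetaData.cor312Of_volumeInputOf_of_badMass_le_large_l` — the `l`-dependent form: for `β < 1` and `l` large
  (`Σ' n,(n+1)²β^{n+1} ≤ ℓ⋇ = (l−1)/2`), bad mass `≤ β` suffices.
* Over `F_mod = ℚ` (`j_E ∈ ℚ`, the abc route) the condition never holds — every bad prime is totally bad: abc-iut-w5-d018's
  `not_badMass_condition_of_finrank_eq_one` (`LDHSplitBadPrimeRational.lean`, p430803; apply it at `I := volumeInputOf D r` with
  `finrank_fieldOfModuli_eq_one_of_j_mem_range`).

READING (neutral): in the tree's sharp Dupuy–Hilado-level model ((Ind1) = all capsule-index permutations, STEPV-IND1-NOTE R2) the typed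
inequality `Cor312Of` is a THEOREM for every collection of initial Θ-data over `F_mod ≠ ℚ` whose chosen `𝕍^bad_mod` is «split enough»
— with no dependence on the height of `E` — so for such data the typed inequality carries no Diophantine content and the [IUTchIV]
squeeze is vacuous (abc-iut-c312-3's «no free lunch»; the necessary-side window of `LDHBadMassWindow`). This is a statement about OUR
typed objects and the CHOICE structure of Def. 3.1 (b); it asserts nothing about print's Cor. 3.12, and the route to `Summit.ABC`
(Frey–Hellegouarch data over `F_mod = ℚ`) is untouched. typed ≠ proved. [cite: Mochizuki2012, IUTchI Def. 3.1 (b)(e) p. 61–62]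
[cite: DupuyHilado2025, §1 (1.1), §3.3, §3.6] [cite: Mochizuki2012, IUTchIII Cor. 3.12 p. 173–174] [claim: Mochizuki2012, status: disputed]
-/

noncomputable section

open NumberField IsDedekindDomain Literature.IUT.LogVolume Literature.IUT.HodgeTheaters

namespace Summit.ABC.IUTFork

namespace InitialThetaData

variable {F K Fbar : Type} [Field F] [NumberField F] [Field K] [NumberField K] [Algebra F K]
  [Field Fbar] [Algebra F Fbar] [Algebra K Fbar] {E : WeierstrassCurve F} [E.IsElliptic] {l : ℕ}
  {Pb : BadPlacePredicates K} (D : Literature.IUT.HodgeTheaters.InitialThetaData F K Fbar E l Pb)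

/-- **The bad-mass TRUE side at INITIAL Θ-DATA**: if the chosen bad places of `D` over every support prime carry at most half of
`[F_mod:ℚ]` (`β_p ≤ 1/2`), then for EVERY idele datum `r` the genuine Θ-volume input `volumeInputOf D r` satisfies `Cor312NonarchOf`
and `Cor312Of` (abc-iut-w5-d018 `ThetaVolumeInput.cor312Of_of_badMass_le_half` at `I := volumeInputOf D r`; `𝕍^bad = 𝕍^bad_mod` by
`pilotData_S`). A theorem about OUR typed objects; no side taken on print's Cor. 3.12. [claim: Mochizuki2012, status: disputed]
[cite: Mochizuki2012, IUTchI Def. 3.1 (b) p. 61] [cite: DupuyHilado2025, §1 (1.1), §3.6] -/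
theorem cor312Of_volumeInputOf_of_badMass_le_half (r : ThetaData.IdeleData D)
    (h : ∀ p ∈ (ThetaData.volumeInputOf D r).supportPrimes,
      ∑ v : placesOver (fieldOfModuli E) p,
        ((ThetaData.badPrimesMod D : Finset _) : Set (HeightOneSpectrum (𝓞 (fieldOfModuli E)))).indicator
          (weight (fieldOfModuli E)) v.1 ≤ 1 / 2) :
    (ThetaData.volumeInputOf D r).Cor312NonarchOf ∧ (ThetaData.volumeInputOf D r).Cor312Of :=
  ThetaVolumeInput.cor312Of_of_badMass_le_half (ThetaData.volumeInputOf D r) h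

/-- **The `l`-dependent form at initial Θ-data**: for `0 ≤ β < 1` with `Σ' n, (n+1)²β^{n+1} ≤ ℓ⋇` (large `l`) and bad mass `≤ β`
at every support prime, `Cor312NonarchOf ∧ Cor312Of` for `volumeInputOf D r`, every `r`. [claim: Mochizuki2012, status: disputed]
[cite: DupuyHilado2025, §3.6] -/
theorem cor312Of_volumeInputOf_of_badMass_le_large_l (r : ThetaData.IdeleData D) {β : ℝ} (h0 : 0 ≤ β) (h1 : β < 1)
    (hL : ∑' n : ℕ, (((n : ℝ) + 1) ^ 2 * β ^ (n + 1)) ≤ ((ThetaData.volumeInputOf D r).lstar : ℝ))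
    (h : ∀ p ∈ (ThetaData.volumeInputOf D r).supportPrimes,
      ∑ v : placesOver (fieldOfModuli E) p,
        ((ThetaData.badPrimesMod D : Finset _) : Set (HeightOneSpectrum (𝓞 (fieldOfModuli E)))).indicator
          (weight (fieldOfModuli E)) v.1 ≤ β) :
    (ThetaData.volumeInputOf D r).Cor312NonarchOf ∧ (ThetaData.volumeInputOf D r).Cor312Of :=
  ThetaVolumeInput.cor312Of_of_badMass_le_of_tsum_le (ThetaData.volumeInputOf D r) h0 h1 hL h

end InitialThetaData

end Summit.ABC.IUTFork

end
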